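import Literature.AnabelianGeometry.EtaleTheta.ThetaKummerClass
import Literature.AnabelianGeometry.EtaleTheta.KummerContH1Conj
import HarnessLib

/-!
# [EtTh] Prop. 1.4 (ii) «Θ̈(−Ü) = −Θ̈(Ü)» at the level of Kummer classes: the deck involution of `Ÿ → Y`
# multiplies the étale theta class by the Kummer class of `−1`

S. Mochizuki, *The étale theta function and its Frobenioid-theoretic manifestations*, Publ. RIMS **45**
(2009), Prop. 1.4 (ii) (PRIMS PDF p. 248) «Θ̈(−Ü) = −Θ̈(Ü)», used on p. 245 («by the classical theory of
the theta function [cf. … the relation “Θ̈(−Ü) = −Θ̈(Ü)” …] … the natural action of Π^tp_Y … preserves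
±τ₁») and, at the level of the classes `O^×_K̈ · η̈^Θ ∈ H¹(Π^tp_Ÿ, Δ_Θ)` of Prop. 1.3/1.4 (iii), by every
consumer that moves `η̈^Θ` along `Gal(Ÿ/Y) ≅ μ₂` ([EtTh] Def. 1.9 / 2.7 the orbit `η̈^{Θ,ℤ×μ₂}`; [IUTchII]
Prop. 2.2 (ii), kurims p. 66). Layer L2 of the abc-iut cell; sub-DAG `plan/L2/SUBDAG-EtTh-Prop14.md`
rows P14/L08b–L09 (seat abc-iut-w5-d125); GAP-LEDGER G-w4d010-2 residual **(P14ii-cl)**, §1-level form.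

The tree's carrier for "the Kummer class of the FUNCTION `Θ̈`" is abc-iut-L2-t12's `ThetaKummerInput T`
(`ThetaKummerClass.lean`): a multiplicative group `T.Fn` of functions on the tempered coverings with its
`Π^tp_X`-action by pull-back (NO carrier for the functions themselves — exactly like `theta_mem`,
`const_mem` there, function-level identities are DATA-level predicates quoting print), the element
`T.theta = Θ̈`, the constants `T.const : K̈^× → Fn`, and `T.kummerTheta = κ(Θ̈) ∈ H¹(Π^tp_Ÿ, Δ_Θ)`.

* the HYPOTHESIS `hdeck` (no definition is introduced; PROOF-ONLY file) — the FUNCTION-LEVEL reading of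
  «Θ̈(−Ü) = −Θ̈(Ü)» for the deck transformations: every `ε ∈ Π^tp_Y ∖ Π^tp_Ÿ` (i.e. mapping to the
  nontrivial element of `Π^tp_Y/Π^tp_Ÿ = Gal(Ÿ/Y) ≅ μ₂`, which acts on `Ÿ` by `Ü ↦ −Ü`, p. 247 «`Ü … on
  Ü = U ×_Y Ÿ`» a square root of `U`) pulls `Θ̈` back to `(−1) · Θ̈`:
  `∀ ε, ε ∈ Π^tp_Y → ε ∉ Π^tp_Ÿ → ε • T.theta = T.const (−1) * T.theta` (it is what a model of `Fn` by actual
  meromorphic functions satisfies by `ClassicalTheta.thetaDdot_neg`, PROVED p403763; `Fn` has no carrier,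
  so at the interface it is a hypothesis on the data, exactly like `theta_mem`).
* PROVED `ThetaKummerInput.conj_kummerTheta_of_deck` — **(P14ii-cl) at the §1 level**: under `hdeck`,
  for `Π^tp_Ÿ ⊴ Π^tp_X` (t1's `Compat.GtpYdd_normal`) and `ε ∈ Π^tp_Y ∖ Π^tp_Ÿ`,
  `ε · κ(Θ̈) = κ(−1) · κ(Θ̈)` in `H¹(Π^tp_Ÿ, Δ_Θ)` — by the equivariance of continuous Kummer classes
  (`CyclotomeCoefficients.conj_kummerContClass_of_smul_eq`, `KummerContH1Conj.lean`) and t12's key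
  computation `kummer_const_mul_theta` (`κ(c · Θ̈) = κ(c) · κ(Θ̈)`).
* PROVED `ThetaKummerInput.kummerConst_mul`, `kummerConst_one`, `kummerConst_neg_one_sq` — `κ` of
  constants is multiplicative (product root systems), so `κ(−1)² = 1`.
* PROVED `ThetaSetting.EtaleThetaData.exists_sq_one_conj_etaDd_of_deck` — the CONSUMER SHAPE (the
  `Δ_Θ`-level input «conj_ε η̈^Θ = η̈^Θ·κ₁, κ₁² = 1» of abc-iut-L2-t8's §2 transport `hsign_of_etaDd_sign`
  towards `Literature.IUT.HodgeArakelov.prop22_ii'_model`, hypothesis `hsign`): if the étale theta class of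
  `E` is the Kummer class of `Θ̈` (`E.etaDd = T.kummerTheta`, the route recorded in `ThetaKummerClass.lean`
  R-8/R-9), then for every `ε ∈ Π^tp_Y ∖ Π^tp_Ÿ` there is `κ` with `κ² = 1` and `ε · η̈^Θ = η̈^Θ · κ`; with
  t12's `ConstCompat`, `κ` is t1's abstract Kummer class of the unit `−1` (`conj_etaDd_eq_mul_kumYdd_neg_one`).

Not here (recorded in the sub-DAG, rows L08b/L09): the ℤ-translates clause «Θ̈(q_X^{a/2}Ü) = …» at the
function level needs the coordinate `Ü` as a member of `Fn` (not a field of `ThetaKummerInput`); the §2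
transport to `rootLiftClass` (l-th roots on `Π^tp_Ÿ̲̲`) is abc-iut-L2-t8's `DoubleUnderline` layer.
No statement of [EtTh] is asserted; Prop. 1.4 is classical and undisputed; nothing here bears on
[IUTchIII] Cor. 3.12. Universe `Type` as in `Setting.lean`.
-/

noncomputable section

namespace Literature.AnabelianGeometry.EtaleTheta

namespace ThetaSetting

variable {p : ℕ} [Fact p.Prime] {D : ThetaSetting p}

namespace ThetaKummerInput

variable (T : D.ThetaKummerInput)

/-! ### Kummer classes of constants are multiplicative -/

/-- `κ(c · d) = κ(c) · κ(d)` for constants `c, d ∈ K̈^×` (product of compatible root systems;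
independence of the root system). [cite: MochizukiEtTh2009, Prop 1.3 p.21] -/
theorem kummerConst_mul (c d : (↥D.Kdd)ˣ) :
    T.kummerConst (c * d) = T.kummerConst c * T.kummerConst d := by
  have hcd : T.const c * T.const d ∈ MulAction.fixedPoints D.GtpYdd T.Fn := by
    rw [← map_mul]; exact T.const_mem (c * d)
  rw [kummerConst, kummerConst, kummerConst,
    ← T.coeff.kummerContClass_mul D.GtpYdd (T.constRoots c) (T.constRoots d) (T.const_mem c)
      (T.const_mem d) hcd (fun _ => T.isOpen_stabilizer _) (fun _ => T.isOpen_stabilizer _)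
      (fun _ => T.isOpen_stabilizer _)]
  exact T.coeff.kummerContClass_eq D.GtpYdd ((T.constRoots (c * d)).cast (map_mul T.const c d)) _ hcd
    (fun _ => T.isOpen_stabilizer _) _

/-- `κ(1) = 1`. [cite: MochizukiEtTh2009, Prop 1.3 p.21] -/
theorem kummerConst_one : T.kummerConst 1 = 1 := by
  have h := T.kummerConst_mul 1 1
  rw [mul_one] at h
  have h' : T.kummerConst 1 * T.kummerConst 1 = T.kummerConst 1 * 1 := by rw [mul_one]; exact h.symm
  exact mul_left_cancel h'

/-- `κ(−1)² = 1`: the Kummer class of the constant `−1` is `2`-torsion. [cite: MochizukiEtTh2009, Prop 1.4 (ii) p.22] -/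
theorem kummerConst_neg_one_sq : T.kummerConst (-1) ^ 2 = 1 := by
  rw [sq, ← T.kummerConst_mul, neg_one_mul, neg_neg, T.kummerConst_one]

/-! ### (P14ii-cl): the deck involution on the Kummer class of `Θ̈` -/

/-- **(P14ii-cl), §1 level — PROVED from the deck form of [EtTh] Prop. 1.4 (ii).** Hypothesis `hdeck`:
«Θ̈(−Ü) = −Θ̈(Ü)» read on the function `Θ̈ ∈ Fn` — every `ε ∈ Π^tp_Y ∖ Π^tp_Ÿ` (inducing the nontrivial
deck transformation `Ü ↦ −Ü` of `Ÿ → Y`, p. 247: `Ü` a square root of `U` on `Ü = U ×_Y Ÿ`) pulls `Θ̈` back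
to `const(−1) · Θ̈` (the series identity is `ClassicalTheta.thetaDdot_neg`, PROVED; `Fn` has no carrier, so
this is a hypothesis on the data, cf. `theta_mem`). Conclusion: for `Π^tp_Ÿ` normal in `Π^tp_X` (t1's
`Compat.GtpYdd_normal`), conjugation by `ε` on `H¹(Π^tp_Ÿ, Δ_Θ)` carries the Kummer class of `Θ̈` to
`κ(−1) · κ(Θ̈)` (equivariance of the continuous Kummer class + `κ(c · Θ̈) = κ(c) · κ(Θ̈)`).
[cite: MochizukiEtTh2009, Prop 1.4 (ii) p.22] -/
theorem conj_kummerTheta_of_deck [D.GtpYdd.Normal]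
    (hdeck : ∀ ε : D.PiTemp, ε ∈ D.GtpY → ε ∉ D.GtpYdd → ε • T.theta = T.const (-1) * T.theta) {ε : D.PiTemp}
    (hε₁ : ε ∈ D.GtpY) (hε₂ : ε ∉ D.GtpYdd) :
    ContH1.conj D.toTheta D.DeltaTheta ε T.kummerTheta = T.kummerConst (-1) * T.kummerTheta := by
  rw [← T.kummer_const_mul_theta (-1), kummerConstMulTheta, kummerTheta]
  exact T.coeff.conj_kummerContClass_of_smul_eq D.GtpYdd ε T.thetaRoots
    ((T.constRoots (-1)).mul T.thetaRoots) T.theta_mem (T.const_mul_theta_mem (-1))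
    (fun _ => T.isOpen_stabilizer _) (fun _ => T.isOpen_stabilizer _) (fun _ => T.isOpen_stabilizer _)
    (hdeck ε hε₁ hε₂)

/-- Elements of `Π^tp_Ÿ` act trivially on the Kummer class of `Θ̈` (they fix the function `Θ̈`,
`theta_mem`): the conjugation action on `κ(Θ̈)` factors through `Π^tp_X/Π^tp_Ÿ`.
[cite: MochizukiEtTh2009, Def 1.9 p.29] -/
theorem conj_kummerTheta_of_mem [D.GtpYdd.Normal] {h : D.PiTemp} (hh : h ∈ D.GtpYdd) :
    ContH1.conj D.toTheta D.DeltaTheta h T.kummerTheta = T.kummerTheta :=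
  T.coeff.conj_kummerContClass_of_mem_stabilizer D.GtpYdd h T.thetaRoots T.theta_mem
    (fun _ => T.isOpen_stabilizer _) (T.theta_mem ⟨h, hh⟩)

end ThetaKummerInput

/-! ### The consumer shape: `∃ κ, κ² = 1 ∧ ε · η̈^Θ = η̈^Θ · κ` -/

namespace EtaleThetaData

variable (T : D.ThetaKummerInput)

/-- **(P14ii-cl) for the étale theta class**, in the shape consumed downstream (hypothesis `hsign` of
`Literature.IUT.HodgeArakelov.prop22_ii'_etaleThetaDataOfSetting`, there at the `l`-th-root level): if
`η̈^Θ` IS the Kummer class of `Θ̈` (route of `ThetaKummerClass.lean`, R-8/R-9) and the deck hypothesis `hdeck` holds,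
then every `ε ∈ Π^tp_Y ∖ Π^tp_Ÿ` satisfies `ε · η̈^Θ = η̈^Θ · κ` for a `2`-torsion class `κ` (namely
`κ(−1)`). [cite: MochizukiEtTh2009, Prop 1.4 (ii) p.22] -/
theorem exists_sq_one_conj_etaDd_of_deck (E : D.EtaleThetaData) [D.GtpYdd.Normal]
    (hdeck : ∀ ε : D.PiTemp, ε ∈ D.GtpY → ε ∉ D.GtpYdd → ε • T.theta = T.const (-1) * T.theta)
    (hη : E.etaDd = T.kummerTheta) {ε : D.PiTemp} (hε₁ : ε ∈ D.GtpY) (hε₂ : ε ∉ D.GtpYdd) :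
    ∃ κ : D.H1 D.GtpYdd, κ ^ 2 = 1 ∧ ContH1.conj D.toTheta D.DeltaTheta ε E.etaDd = E.etaDd * κ :=
  ⟨T.kummerConst (-1), T.kummerConst_neg_one_sq, by
    rw [hη, T.conj_kummerTheta_of_deck hdeck hε₁ hε₂, mul_comm]⟩

/-- Same, identifying `κ` with t1's abstract Kummer class of the unit `−1 ∈ K̈^×` under t12's
`ConstCompat`: `ε · η̈^Θ = η̈^Θ · κ_{K̈}(−1)`. [cite: MochizukiEtTh2009, Prop 1.4 (ii) p.22] -/
theorem conj_etaDd_eq_mul_kumYdd_neg_one (E : D.EtaleThetaData) [D.GtpYdd.Normal]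
    (hdeck : ∀ ε : D.PiTemp, ε ∈ D.GtpY → ε ∉ D.GtpYdd → ε • T.theta = T.const (-1) * T.theta)
    (hη : E.etaDd = T.kummerTheta) (hc : T.ConstCompat E.toKummerData)
    {ε : D.PiTemp} (hε₁ : ε ∈ D.GtpY) (hε₂ : ε ∉ D.GtpYdd) :
    ContH1.conj D.toTheta D.DeltaTheta ε E.etaDd =
      E.etaDd * D.inflTheta D.GtpYdd (E.kumYdd (E.toKddHat (-1))) := by
  rw [hc (-1), hη, T.conj_kummerTheta_of_deck hdeck hε₁ hε₂, mul_comm]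

end EtaleThetaData

end ThetaSetting

end Literature.AnabelianGeometry.EtaleTheta

end
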